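import Literature.NumberTheory.GaloisRepresentations.HeckeCharacterArchTypeProofs
import Mathlib.GroupTheory.FiniteAbelian.Basic
import HarnessLib

/-!
# Weil's unit criterion for archimedean types in its «finite-index subgroup» form
# (Patrikis 2019, Lemma 2.1.1, last sentence): proofs

Topic `NumberTheory/GaloisRepresentations`; namespace `Literature.NumberTheory.GaloisRepresentations`.
Proof file (theorems only: no definition, no named fact, no instance, no `sorry`), a short
complement to `HeckeCharacterArchTypeProofs.lean`.

Patrikis 2019 (= arXiv:1207.6724), §2.1, Lemma 2.1.1 states Weil's criterion with the unit
condition "for some positive integer `M`, all global units `α ∈ 𝓞_Fˣ` satisfy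
`(∏_{v ∣ ∞} (ι_v(α)/|ι_v(α)|)^{m_v} |ι_v(α)|^{i t_v})^M = 1`" and adds: "**Equivalently, the inside
product is trivial for all `α` in some finite-index subgroup of `𝓞_Fˣ`.**"  The tree proves the
criterion in the first form (`Patrikis2019_heckeCharacter_archType_iff_units_holds`).  This file
records the printed equivalence of the two unit conditions and the criterion in the second form,
which is the shape in which it is quoted for CM fields ("a unitary character of `L_∞ˣ` trivial on a
subgroup of finite index of `𝓞_Lˣ` is the infinite component of a unitary Hecke character of `L`";
e.g. Shimura 1971 §8 / Weil 1956 for Grössencharaktere of type `A₀`).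

* `exists_pow_prod_archUnitaryValue_unit_eq_one_iff_exists_finiteIndex`: for the unit-side product
  `P(α) = ∏_w (ι_w α/|ι_w α|)^{m_w} |ι_w α|^{i t_w}` (multiplicative in `α`),
  `(∃ M > 0, ∀ α, P(α)^M = 1) ↔ (∃ H ≤ 𝓞_Kˣ of finite index, ∀ α ∈ H, P(α) = 1)`.
  (⇒) `H = (𝓞_Kˣ)^M`, of finite index because `𝓞_Kˣ` is finitely generated (Dirichlet; Mathlib
  `Monoid.FG (𝓞 K)ˣ`, `Subgroup.finiteIndex_range_powMonoidHom_of_fg`); (⇐) `M = [𝓞_Kˣ : H]` and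
  `α^M ∈ H` (`Subgroup.pow_index_mem`).
* `HeckeCharacter.exists_isUnitary_hasUnitaryArchType_iff_exists_finiteIndex`: a unitary Hecke
  character of unitary archimedean type `(m, t)` exists iff `P` kills a finite-index subgroup of
  `𝓞_Kˣ` — and the two one-directional corollaries.

## References

* S. Patrikis, *Variations on a theorem of Tate*, Mem. AMS 258 (2019), no. 1238 = arXiv:1207.6724,
  §2.1, Lemma 2.1.1 (last sentence). [Patrikis2019]
* A. Weil, *On a certain type of characters of the idèle-class group of an algebraic
  number-field*, Proc. Int. Symp. Tokyo–Nikko 1955 (1956), 1–7, §1. [Weil1956]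
-/

noncomputable section

open scoped NumberField
open NumberField

namespace Literature.NumberTheory.GaloisRepresentations

variable {K : Type} [Field K] [NumberField K]

/-- **The two unit conditions of Patrikis 2019, Lemma 2.1.1 are equivalent.**  For parameters
`(m_w, t_w)_w` and the unit-side product `P(α) = ∏_w (ι_w α/|ι_w α|)^{m_w} |ι_w α|^{i t_w}`:
some power `M > 0` of `P` kills every global unit iff `P` itself kills a subgroup of finite index
of `𝓞_Kˣ`.  (⇒): the `M`-th powers form a finite-index subgroup since `𝓞_Kˣ` is finitely generated
(Dirichlet's unit theorem); (⇐): take `M` = the index, as `α^M` lies in any subgroup of index `M`.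
[cite: Patrikis2019, Lemma 2.1.1 (last sentence)] -/
theorem exists_pow_prod_archUnitaryValue_unit_eq_one_iff_exists_finiteIndex
    (m : InfinitePlace K → ℤ) (t : InfinitePlace K → ℝ) :
    (∃ M : ℕ, 0 < M ∧ ∀ α : (𝓞 K)ˣ,
        (∏ w : InfinitePlace K, archUnitaryValue (m w) (t w) (w.embedding ((α : 𝓞 K) : K))) ^ M
          = 1) ↔
      ∃ H : Subgroup (𝓞 K)ˣ, H.FiniteIndex ∧ ∀ α ∈ H,
        ∏ w : InfinitePlace K, archUnitaryValue (m w) (t w) (w.embedding ((α : 𝓞 K) : K)) = 1 := by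
  constructor
  · rintro ⟨M, hM, h⟩
    haveI : Group.FG (𝓞 K)ˣ := Group.fg_iff_monoid_fg.mpr inferInstance
    refine ⟨(powMonoidHom M).range,
      Subgroup.finiteIndex_range_powMonoidHom_of_fg (𝓞 K)ˣ (Nat.pos_iff_ne_zero.mp hM), ?_⟩
    rintro _ ⟨α, rfl⟩
    rw [powMonoidHom_apply, prod_archUnitaryValue_embedding_unit_pow]
    exact h α
  · rintro ⟨H, hH, h⟩
    refine ⟨H.index, Nat.pos_of_ne_zero Subgroup.FiniteIndex.index_ne_zero, fun α => ?_⟩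
    rw [← prod_archUnitaryValue_embedding_unit_pow]
    exact h _ (H.pow_index_mem α)

/-- **Weil's criterion (Patrikis 2019, Lemma 2.1.1) in the finite-index form.**  For a number field
`K` and parameters `m_w ∈ ℤ`, `t_w ∈ ℝ` (`w ∣ ∞`): a unitary Hecke character `ψ` of `K` with
archimedean component `ψ((x,1)) = ∏_w (ι_w x_w/|ι_w x_w|)^{m_w} |ι_w x_w|^{i t_w}` exists **iff**
the unit-side product `∏_w (ι_w α/|ι_w α|)^{m_w} |ι_w α|^{i t_w}` is trivial for all `α` in some
subgroup of finite index of `𝓞_Kˣ`.  (`Patrikis2019_heckeCharacter_archType_iff_units_holds`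
combined with `exists_pow_prod_archUnitaryValue_unit_eq_one_iff_exists_finiteIndex`.)
[cite: Patrikis2019, Lemma 2.1.1] -/
theorem HeckeCharacter.exists_isUnitary_hasUnitaryArchType_iff_exists_finiteIndex
    (m : InfinitePlace K → ℤ) (t : InfinitePlace K → ℝ) :
    (∃ ψ : HeckeCharacter K, ψ.IsUnitary ∧ ψ.HasUnitaryArchType m t) ↔
      ∃ H : Subgroup (𝓞 K)ˣ, H.FiniteIndex ∧ ∀ α ∈ H,
        ∏ w : InfinitePlace K, archUnitaryValue (m w) (t w) (w.embedding ((α : 𝓞 K) : K)) = 1 :=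
  (Patrikis2019_heckeCharacter_archType_iff_units_holds K m t).trans
    (exists_pow_prod_archUnitaryValue_unit_eq_one_iff_exists_finiteIndex m t)

/-- **Existence of a unitary Hecke character with prescribed unitary archimedean type** (the (⇐)
half in the finite-index form, as used for Grössencharaktere of type `A₀` of CM fields): if the
character `x ↦ ∏_w (ι_w x_w/|ι_w x_w|)^{m_w} |ι_w x_w|^{i t_w}` of `(K ⊗ ℝ)ˣ` is trivial on a subgroup
of finite index of the global units, then it is the infinite component of a unitary Hecke character
of `K`. [cite: Patrikis2019, Lemma 2.1.1] -/
theorem HeckeCharacter.exists_isUnitary_hasUnitaryArchType_of_finiteIndex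
    (m : InfinitePlace K → ℤ) (t : InfinitePlace K → ℝ) (H : Subgroup (𝓞 K)ˣ) [H.FiniteIndex]
    (hH : ∀ α ∈ H,
      ∏ w : InfinitePlace K, archUnitaryValue (m w) (t w) (w.embedding ((α : 𝓞 K) : K)) = 1) :
    ∃ ψ : HeckeCharacter K, ψ.IsUnitary ∧ ψ.HasUnitaryArchType m t :=
  (HeckeCharacter.exists_isUnitary_hasUnitaryArchType_iff_exists_finiteIndex m t).2 ⟨H, ‹_›, hH⟩

/-- **Necessity in the finite-index form**: the archimedean type `(m, t)` of any Hecke character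
kills a subgroup of finite index of `𝓞_Kˣ` (unitarity is not needed:
`HasUnitaryArchType.exists_pow_prod_archUnitaryValue_unit_eq_one`). [cite: Patrikis2019, Lemma 2.1.1] -/
theorem HeckeCharacter.HasUnitaryArchType.exists_finiteIndex_prod_archUnitaryValue_unit_eq_one
    {ψ : HeckeCharacter K} {m : InfinitePlace K → ℤ} {t : InfinitePlace K → ℝ}
    (hψ : ψ.HasUnitaryArchType m t) :
    ∃ H : Subgroup (𝓞 K)ˣ, H.FiniteIndex ∧ ∀ α ∈ H,
      ∏ w : InfinitePlace K, archUnitaryValue (m w) (t w) (w.embedding ((α : 𝓞 K) : K)) = 1 :=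
  (exists_pow_prod_archUnitaryValue_unit_eq_one_iff_exists_finiteIndex m t).1
    hψ.exists_pow_prod_archUnitaryValue_unit_eq_one

end Literature.NumberTheory.GaloisRepresentations
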